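import Mathlib
import Summits.Ventures.PercRepro2.Defs
import Summits.Ventures.PercRepro2.Graph
import Summits.Ventures.PercRepro2.Harris
import Summits.Ventures.PercRepro2.Events
import Summits.Ventures.PercRepro2.Induced
import Summits.Ventures.PercRepro2.SeedSet
import Summits.Ventures.PercRepro2.CrossRootT
import Summits.Ventures.PercRepro2.BHKAvoid
import Summits.Ventures.PercRepro2.LemmaA

/-!
# The shift part of the free one-sided gate is a theorem (blind cell PercRepro2, mine-c g7,
proofs/MINEC-LIND.md §5, MINE-C.md §14.3)

Root `s`, avoided vertex `t` (`R = {s ↮ t}`), markers `a, b` (`X = {a ∈ C(s)}`, `Y = {b ∈ C(s)}`),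
gate vertices `u, w`. The one-sided gate `R ∖ {u ∈ C(s), w ∈ C(t)}` is the disjoint union of the two
classes `A = R ∩ {w ∉ C(t)}` and `B = {w ∈ C(t)} ∩ {s ↮ t, s ↮ u}`, and by the law of total covariance

  `Φ(gate) = Σ_{C ∈ {A,B}} P(C)(E[X|C] − m_X)(E[Y|C] − m_Y) + Σ_{C} P(C) Cov(X,Y | C)`.

This file proves that the SHIFT part (the first sum, cleared by `P(R)² P(A) P(B)`) is nonnegative:
on `A` both shifts are `≥ 0` (cross-cluster BHK 1.4 for the hull of `t` against the root cluster,
`bhk_cross_clusterT`), on `B` both are `≤ 0` (cross-cluster BHK with the avoided set `{t, u}`,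
`bhk_cross_cluster_avoid`, followed by the avoided-set monotonicity `shift_avoid_more`). Hence the whole
content of the free gate is the within-class covariance term (mine-c §14.3: the gate is exactly tight on
two-class mixtures; `Cov(X,Y | B)` is not sign-definite, 1,858 / 38,088 negatives at `n = 6`).
-/

namespace Summit.Ventures.PercRepro2

namespace GateShift

variable {V : Type*} {E : Type*} [Fintype E] [DecidableEq E] [Fintype V] [DecidableEq V]
  {R : Type*} [Field R] [LinearOrder R] [IsStrictOrderedRing R]

variable (p : E → R) (ends : E → Sym2 V)

omit [Fintype E] [DecidableEq E] [Fintype V] [DecidableEq V] [LinearOrder R] [IsStrictOrderedRing R] in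
/-- `{W | v ∈ W}` is an up-set of vertex sets. -/
lemma isUpperSet_mem (v : V) : IsUpperSet {W : Set V | v ∈ W} := fun _ _ h hv => h hv

omit [Fintype E] [DecidableEq E] [Fintype V] [DecidableEq V] [LinearOrder R] [IsStrictOrderedRing R] in
/-- The hull of the single seed `t` hitting `w` is the cluster event `{w ∈ C(t)}`. -/
lemma clusterSetIn_singleton (t w : V) :
    clusterSetInEvent ends {t} {W : Set V | w ∈ W} = clusterInEvent ends t {W : Set V | w ∈ W} := by
  ext ω
  simp [clusterSetInEvent, clusterSet, clusterInEvent, cluster]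

omit [Fintype E] [DecidableEq E] [Fintype V] [DecidableEq V] [LinearOrder R] [IsStrictOrderedRing R] in
/-- `{t ↮ s}` for the seed set `{t}` is `{s ↮ t}`. -/
lemma avoidAllT_singleton (s t : V) : avoidAllT ends {t} {s} = avoidAll ends s {t} := by
  ext ω
  simp only [avoidAllT, avoidAll, Set.mem_setOf_eq, Finset.mem_singleton, forall_eq]
  exact ⟨fun h h' => h (conn_symm h'), fun h h' => h (conn_symm h')⟩

omit [Fintype E] [DecidableEq E] [Fintype V] [DecidableEq V] [LinearOrder R] [IsStrictOrderedRing R] in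
/-- `{a ∈ C(s)}` is `connAll s {a}`. -/
lemma clusterInEvent_mem_eq_connAll (s a : V) :
    clusterInEvent ends s {W : Set V | a ∈ W} = connAll ends s {a} := by
  ext ω
  simp [clusterInEvent, cluster, connAll]

section Main

variable (s t a b u w : V)

/-- **Class A shift**: `P(R) · P(X; R, w ∉ C(t)) ≥ P(X; R) · P(R, w ∉ C(t))` — the marker event and the
hull-hitting event are negatively correlated given `R` (`bhk_cross_clusterT`). -/
lemma shiftA_nonneg (hp : IsProbVec p) :
    prob p (connAll ends s {a} ∩ avoidAll ends s {t}) *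
        prob p (avoidAll ends s {t} ∩ (clusterInEvent ends t {W : Set V | w ∈ W})ᶜ) ≤
      prob p (avoidAll ends s {t}) *
        prob p (connAll ends s {a} ∩ (avoidAll ends s {t} ∩ (clusterInEvent ends t {W : Set V | w ∈ W})ᶜ)) := by
  have h := bhk_cross_clusterT p hp ends {t} s (𝓤 := {W : Set V | w ∈ W}) (𝓥 := {W : Set V | a ∈ W})
    (isUpperSet_mem w) (isUpperSet_mem a)
  rw [clusterSetIn_singleton, avoidAllT_singleton, clusterInEvent_mem_eq_connAll ends s a] at h
  -- split the masses along `{w ∈ C(t)}`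
  have e1 := prob_inter_add_prob_inter_compl p (connAll ends s {a} ∩ avoidAll ends s {t}) (clusterInEvent ends t {W : Set V | w ∈ W})
  have e2 := prob_inter_add_prob_inter_compl p (avoidAll ends s {t}) (clusterInEvent ends t {W : Set V | w ∈ W})
  have s1 : connAll ends s {a} ∩ avoidAll ends s {t} ∩ clusterInEvent ends t {W : Set V | w ∈ W} =
      clusterInEvent ends t {W : Set V | w ∈ W} ∩ connAll ends s {a} ∩ avoidAll ends s {t} := by
    ext ω; simp only [Set.mem_inter_iff]; tauto
  have s2 : avoidAll ends s {t} ∩ clusterInEvent ends t {W : Set V | w ∈ W} = clusterInEvent ends t {W : Set V | w ∈ W} ∩ avoidAll ends s {t} := Set.inter_comm _ _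
  have s3 : connAll ends s {a} ∩ avoidAll ends s {t} ∩ (clusterInEvent ends t {W : Set V | w ∈ W})ᶜ =
      connAll ends s {a} ∩ (avoidAll ends s {t} ∩ (clusterInEvent ends t {W : Set V | w ∈ W})ᶜ) := Set.inter_assoc _ _ _
  rw [s1, s3] at e1
  rw [s2] at e2
  nlinarith [h, e1, e2, prob_nonneg hp (connAll ends s {a} ∩ avoidAll ends s {t}),
    prob_nonneg hp (avoidAll ends s {t})]

/-- **Class B shift**: `P(R) · P(X; w ∈ C(t), s ↮ t, s ↮ u) ≤ P(X; R) · P(w ∈ C(t), s ↮ t, s ↮ u)` —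
cross-cluster BHK with the avoided set `{t, u}` and then the avoided-set monotonicity. -/
lemma shiftB_nonpos (hp : IsProbVec p) :
    prob p (avoidAll ends s {t}) *
        prob p (connAll ends s {a} ∩ (clusterInEvent ends t {W : Set V | w ∈ W} ∩ avoidAll ends s ({t} ∪ {u}))) ≤
      prob p (connAll ends s {a} ∩ avoidAll ends s {t}) *
        prob p (clusterInEvent ends t {W : Set V | w ∈ W} ∩ avoidAll ends s ({t} ∪ {u})) := by
  have ht : t ∈ ({t} ∪ {u} : Finset V) := by simp
  have h1 := bhk_cross_cluster_avoid p hp ends s t ht (𝓤 := {W : Set V | a ∈ W})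
    (𝓥 := {W : Set V | w ∈ W}) (isUpperSet_mem a) (isUpperSet_mem w)
  rw [clusterInEvent_mem_eq_connAll ends s a] at h1
  have h2 := MineCLemmas.shift_avoid_more p ends hp s {a} {t} {u}
  -- q := P(s ↮ t, s ↮ u); if q = 0 the class B is null
  set q := prob p (avoidAll ends s ({t} ∪ {u})) with hq
  set r := prob p (avoidAll ends s {t}) with hr
  set xB := prob p (connAll ends s {a} ∩ (clusterInEvent ends t {W : Set V | w ∈ W} ∩ avoidAll ends s ({t} ∪ {u}))) with hxB
  set bB := prob p (clusterInEvent ends t {W : Set V | w ∈ W} ∩ avoidAll ends s ({t} ∪ {u})) with hbB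
  set xq := prob p (connAll ends s {a} ∩ avoidAll ends s ({t} ∪ {u})) with hxq
  set x := prob p (connAll ends s {a} ∩ avoidAll ends s {t}) with hx
  have e1 : connAll ends s {a} ∩ clusterInEvent ends t {W : Set V | w ∈ W} ∩ avoidAll ends s ({t} ∪ {u}) =
      connAll ends s {a} ∩ (clusterInEvent ends t {W : Set V | w ∈ W} ∩ avoidAll ends s ({t} ∪ {u})) := Set.inter_assoc _ _ _
  rw [e1] at h1
  -- h1 : xB * q ≤ xq * bB ;  h2 : xq * r ≤ x * q
  have hq0 : 0 ≤ q := prob_nonneg hp _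
  have hr0 : 0 ≤ r := prob_nonneg hp _
  have hbB0 : 0 ≤ bB := prob_nonneg hp _
  have hx0 : 0 ≤ x := prob_nonneg hp _
  have hxB0 : 0 ≤ xB := prob_nonneg hp _
  rcases hq0.lt_or_eq with hqpos | hq0'
  · -- multiply the chain through by r resp. bB and cancel q > 0
    have := calc xB * q * r ≤ xq * bB * r := by nlinarith [h1, hr0]
      _ = (xq * r) * bB := by ring
      _ ≤ (x * q) * bB := by nlinarith [h2, hbB0]
    have key : q * (r * xB - x * bB) ≤ 0 := by nlinarith [this]
    exact le_of_mul_le_mul_left (by linarith [key] : q * (r * xB) ≤ q * (x * bB)) hqpos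
  · -- q = 0: the class B (a subset of the avoidance event) is null
    have hsub : clusterInEvent ends t {W : Set V | w ∈ W} ∩ avoidAll ends s ({t} ∪ {u}) ⊆ avoidAll ends s ({t} ∪ {u}) :=
      Set.inter_subset_right
    have h3 : bB ≤ q := prob_mono hp hsub
    have h4 : xB ≤ bB := prob_mono hp Set.inter_subset_right
    have hbB : bB = 0 := by linarith
    have hxB : xB = 0 := by linarith
    rw [hbB, hxB]; simp

/-- **The shift part of the free gate is nonnegative** (cleared by `P(R)² · P(A) · P(B)`):
`0 ≤ P(B)·(r·x_A − x·P(A))·(r·y_A − y·P(A)) + P(A)·(r·x_B − x·P(B))·(r·y_B − y·P(B))`, where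
`A = R ∩ {w ∉ C(t)}`, `B = {w ∈ C(t)} ∩ {s ↮ t, s ↮ u}` partition the one-sided gate
`R ∖ {u ∈ C(s), w ∈ C(t)}`. -/
theorem gateShift_nonneg (hp : IsProbVec p) :
    0 ≤ prob p (clusterInEvent ends t {W : Set V | w ∈ W} ∩ avoidAll ends s ({t} ∪ {u})) *
          ((prob p (avoidAll ends s {t}) *
                prob p (connAll ends s {a} ∩ (avoidAll ends s {t} ∩ (clusterInEvent ends t {W : Set V | w ∈ W})ᶜ)) -
              prob p (connAll ends s {a} ∩ avoidAll ends s {t}) *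
                prob p (avoidAll ends s {t} ∩ (clusterInEvent ends t {W : Set V | w ∈ W})ᶜ)) *
            (prob p (avoidAll ends s {t}) *
                prob p (connAll ends s {b} ∩ (avoidAll ends s {t} ∩ (clusterInEvent ends t {W : Set V | w ∈ W})ᶜ)) -
              prob p (connAll ends s {b} ∩ avoidAll ends s {t}) *
                prob p (avoidAll ends s {t} ∩ (clusterInEvent ends t {W : Set V | w ∈ W})ᶜ))) +
        prob p (avoidAll ends s {t} ∩ (clusterInEvent ends t {W : Set V | w ∈ W})ᶜ) *
          ((prob p (avoidAll ends s {t}) *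
                prob p (connAll ends s {a} ∩ (clusterInEvent ends t {W : Set V | w ∈ W} ∩ avoidAll ends s ({t} ∪ {u}))) -
              prob p (connAll ends s {a} ∩ avoidAll ends s {t}) *
                prob p (clusterInEvent ends t {W : Set V | w ∈ W} ∩ avoidAll ends s ({t} ∪ {u}))) *
            (prob p (avoidAll ends s {t}) *
                prob p (connAll ends s {b} ∩ (clusterInEvent ends t {W : Set V | w ∈ W} ∩ avoidAll ends s ({t} ∪ {u}))) -
              prob p (connAll ends s {b} ∩ avoidAll ends s {t}) *
                prob p (clusterInEvent ends t {W : Set V | w ∈ W} ∩ avoidAll ends s ({t} ∪ {u})))) := by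
  have hA1 := shiftA_nonneg p ends s t a w hp
  have hA2 := shiftA_nonneg p ends s t b w hp
  have hB1 := shiftB_nonpos p ends s t a u w hp
  have hB2 := shiftB_nonpos p ends s t b u w hp
  have hPA := prob_nonneg hp (avoidAll ends s {t} ∩ (clusterInEvent ends t {W : Set V | w ∈ W})ᶜ)
  have hPB := prob_nonneg hp (clusterInEvent ends t {W : Set V | w ∈ W} ∩ avoidAll ends s ({t} ∪ {u}))
  have t1 : 0 ≤ (prob p (avoidAll ends s {t}) *
        prob p (connAll ends s {a} ∩ (avoidAll ends s {t} ∩ (clusterInEvent ends t {W : Set V | w ∈ W})ᶜ)) -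
      prob p (connAll ends s {a} ∩ avoidAll ends s {t}) *
        prob p (avoidAll ends s {t} ∩ (clusterInEvent ends t {W : Set V | w ∈ W})ᶜ)) := by linarith
  have t2 : 0 ≤ (prob p (avoidAll ends s {t}) *
        prob p (connAll ends s {b} ∩ (avoidAll ends s {t} ∩ (clusterInEvent ends t {W : Set V | w ∈ W})ᶜ)) -
      prob p (connAll ends s {b} ∩ avoidAll ends s {t}) *
        prob p (avoidAll ends s {t} ∩ (clusterInEvent ends t {W : Set V | w ∈ W})ᶜ)) := by linarith
  have t3 : (prob p (avoidAll ends s {t}) *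
        prob p (connAll ends s {a} ∩ (clusterInEvent ends t {W : Set V | w ∈ W} ∩ avoidAll ends s ({t} ∪ {u}))) -
      prob p (connAll ends s {a} ∩ avoidAll ends s {t}) *
        prob p (clusterInEvent ends t {W : Set V | w ∈ W} ∩ avoidAll ends s ({t} ∪ {u}))) ≤ 0 := by linarith
  have t4 : (prob p (avoidAll ends s {t}) *
        prob p (connAll ends s {b} ∩ (clusterInEvent ends t {W : Set V | w ∈ W} ∩ avoidAll ends s ({t} ∪ {u}))) -
      prob p (connAll ends s {b} ∩ avoidAll ends s {t}) *
        prob p (clusterInEvent ends t {W : Set V | w ∈ W} ∩ avoidAll ends s ({t} ∪ {u}))) ≤ 0 := by linarith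
  have m1 := mul_nonneg hPB (mul_nonneg t1 t2)
  have m2 := mul_nonneg hPA (mul_nonneg_of_nonpos_of_nonpos t3 t4)
  linarith

end Main

end GateShift

end Summit.Ventures.PercRepro2
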